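import Summits.ResolutionOfSingularities.ResolutionOfSingularities.Theorems.FrobeniusLadderFInjectiveMacaulayficationLocalFullificationFibreClosedGe4
import HarnessLib

/-!
# (LF_adm) `LocalFullificationFibreAdmGe4` — (LF_cl) restricted to SINGULAR closed points and Sing-ADMISSIBLE blow-ups: the F-side local statement in
# exactly Temkin's category (Prop. 2.3.4 (iii): `X_reg`-admissible blowing ups of the local scheme), in FULL currency
# (crux `FInjectiveMacaulayfication` stmt-ResolutionOfSingularities-15315, chain w45a; door v36.x refinement; folds res-L1-w45a-stub-3's «(LF_cl,sing)» offer
# (x singular) with the admissible-centre restriction; seat res-L1-w45a-stub-2 g6)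

[OURS · L1 W4.5a] STATEMENT file (`--supports stmt-ResolutionOfSingularities-15315 --as helper`); ONE `Prop`-valued CANDIDATE statement of OURS
(`@[conjecture] def`, consumed only as a hypothesis; no instance, no notation, no named fact) and its comparison with (LF_cl); replaces the role of NO
printed item; NOT a statement of the manuscript; AI-written (AI review is weaker than expert review).

WHAT. (LF_adm) = (LF_cl) `LocalFullificationFibreClosedGe4.LocalFullificationFibreClosedGe4` (p588526) with TWO insertions and nothing else touched:
`x ∉ Scheme.regularLocus X →` after `IsClosed ({x} : Set X) →` (the closed point is SINGULAR), and
`(I.support : Set (Spec (X.presheaf.stalk x))) ⊆ (Scheme.regularLocus (Spec (X.presheaf.stalk x)))ᶜ →` after `I ≠ ⊥ →` (the blowing up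
`g : S′ → Spec 𝒪_{X,x}` is `X_reg`-ADMISSIBLE: its centre lies in the singular locus of the local scheme — Temkin 2008 §2.1/Def. 2.2.6). In words: for every
`d ≥ 4`, every integral variety `X/k` (`char k = p`), every SINGULAR CLOSED point `x` of local dimension `d`, and every Sing-admissible blowing up
`S′ → Spec 𝒪_{X,x}` along `I ≠ ⊥` that is regular off its closed fibre, there is a fibre-supported centre `𝓚 ≠ ⊥` on `S′` all of whose blowings up are
FULL at every point.
* `localFullificationFibreAdmGe4_of_closedGe4 : LocalFullificationFibreClosedGe4 → LocalFullificationFibreAdmGe4` (drop the two hypotheses).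

WHY IT SUFFICES (checked on the tree text by this seat; companion engine `…FTemkinClosedPointsAdm`). The dimension-free F-Temkin engine
(`FTemkinClosedPointsLocal.full_model_of_regularOffFinite_of_localClosed`, p588600) invokes its local hypothesis ONLY at closed points `b ∉ Reg X` (the
branch `b ∈ Reg X` is disposed of by the isomorphism of the model over `(Supp J)ᶜ`), and ONLY for the local model `X′ ×_X Spec 𝒪_{X,b}`, a blowing up of
`Spec 𝒪_{X,b}` along `J·𝒪` whose support is `fromSpecStalk⁻¹(Supp J) ⊆ fromSpecStalk⁻¹(Sing X) = Sing(Spec 𝒪_{X,b})` (`support_comap`; the local scheme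
has the same local rings, `isIso_stalkMap_fromSpecStalk`) — THEOREM A-gen's centre `J` is `Sing X`-supported by construction. WHY NOT COSMETIC: without
the two hypotheses (LF_cl) also demands FULL-ification of every fibre-singular blowing up of a REGULAR local ring along an ARBITRARY ideal — inputs no
assembly produces; (LF_adm) speaks only about admissible blow-ups at singular points.
JUNK CHECKS: `I = ⊤` is admissible (empty support) and gives `S′ = Spec 𝒪_{X,x}` — then (LF_adm) asks for a fibre-supported (i.e. `𝔪_x`-primary-cosupported
or trivial) FULL-ification of an ISOLATED-over-the-fibre… no: of the local ring itself, regular off the closed point = the isolated-singularity core (KILL-1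
instance), intended; `x` regular is excluded (vacuous there before only via `𝓚 := ⊤` after checking `S′`); ≤ S_loc exactly as (LF_cl) (Temkin (iii) is
stated for admissible blow-ups with fibre-singularities — literally this category).
[candidate statement, OURS; cite: Temkin2008, Prop. 2.3.4 (iii), Def. 2.2.6 and §2.1 (admissible blow-ups)]
-/

-- single-problem summit: the doubled namespace component is forced
set_option linter.dupNamespace false

noncomputable section

open AlgebraicGeometry CategoryTheory Literature.AlgebraicGeometry.Resolution TopologicalSpace IsLocalRing

namespace Summit.ResolutionOfSingularities.ResolutionOfSingularities.Theorems.FInjectiveMacaulayfication.LocalFullificationFibreAdmGe4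

open Summit.ResolutionOfSingularities.ResolutionOfSingularities.Theorems.FInjectiveMacaulayfication

/-- [OURS · CANDIDATE statement, not a fact] **(LF_adm) LOCAL FULL-IFICATION OF Sing-ADMISSIBLE BLOW-UPS AT SINGULAR CLOSED POINTS OF LOCAL
DIMENSION `d ≥ 4`, FIBRE-SUPPORTED CENTRE.** For every `d ≥ 4`: for a prime `p`, a field `k` of characteristic `p`, an integral separated `k`-scheme `X`
of finite type, a CLOSED point `x ∉ Reg X` with `dim 𝒪_{X,x} = d`, and a blowing up `g : S′ → Spec 𝒪_{X,x}` along an ideal sheaf `I ≠ ⊥` SUPPORTED IN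
`Sing(Spec 𝒪_{X,x})` such that `S′` is regular off the closed fibre: there is an ideal sheaf `𝓚 ≠ ⊥` on `S′`, supported in the closed fibre, such that
EVERY blowing up `S″ → S′` along `𝓚` is FULL at EVERY point (`SliceableCentre.FullCl`). = (LF_cl) restricted to singular `x` and admissible `I`.
[candidate statement, OURS; open for every `d ≥ 4`] -/
@[conjecture] def LocalFullificationFibreAdmGe4 : Prop :=
  ∀ d : ℕ, 4 ≤ d →
  ∀ (p : ℕ), p.Prime → ∀ (k : Type) [Field k] [CharP k p]
    (X : Scheme.{0}) (f : X ⟶ Spec (.of k)),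
      IsSeparated f → LocallyOfFiniteType f → QuasiCompact f → IsIntegral X →
      ∀ x : X, IsClosed ({x} : Set X) → x ∉ Scheme.regularLocus X → ringKrullDim (X.presheaf.stalk x) = d →
      ∀ (S' : Scheme.{0}) (g : S' ⟶ Spec (X.presheaf.stalk x)) (I : (Spec (X.presheaf.stalk x)).IdealSheafData),
        I ≠ ⊥ → (I.support : Set (Spec (X.presheaf.stalk x))) ⊆ (Scheme.regularLocus (Spec (X.presheaf.stalk x)))ᶜ → IsBlowup g I →
        (∀ s : S', g.base s ≠ closedPoint (X.presheaf.stalk x) → s ∈ Scheme.regularLocus S') →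
        ∃ 𝓚 : S'.IdealSheafData, 𝓚 ≠ ⊥ ∧ (∀ s ∈ (𝓚.support : Set S'), g.base s = closedPoint (X.presheaf.stalk x)) ∧
          ∀ (S'' : Scheme.{0}) (π : S'' ⟶ S'), IsBlowup π 𝓚 →
            ∀ s : S'', SliceableCentre.FullCl p (S''.presheaf.stalk s)

/-- **(LF_cl) ⇒ (LF_adm)**: drop the two extra hypotheses. [folklore] -/
theorem localFullificationFibreAdmGe4_of_closedGe4 (h : LocalFullificationFibreClosedGe4.LocalFullificationFibreClosedGe4) :
    LocalFullificationFibreAdmGe4 :=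
  fun d hd p hp k _ _ X f hsep hft hqc hint x hxcl _ hx S' g I hI _ hg hreg =>
    h d hd p hp k X f hsep hft hqc hint x hxcl hx S' g I hI hg hreg

end Summit.ResolutionOfSingularities.ResolutionOfSingularities.Theorems.FInjectiveMacaulayfication.LocalFullificationFibreAdmGe4

end
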